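import Literature.NumberTheory.Rogawski1990.ArchCharactersRealCase           -- ★ (γ) p827732 (A-p06 (g23)): `archRealCase_of_package`, §1–§2 helpers; ★ A8 via its imports
import Literature.NumberTheory.Rogawski1990.ArchTestKcPackage                -- ★ (β) p827885 (F0P3b-p01 (g0)): `archTestKc_package`
import Literature.NumberTheory.Rogawski1990.ArchCharactersLinIndep           -- ★ p825905 (typ-T1a): the HEAD text `ArchCharactersLinIndep`
import Literature.NumberTheory.Automorphic.GKInfinitesimallyUnitaryConverse  -- ★ (α) (A-p14 (g22)): `sixClauses_holds`
import HarnessLib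

/-!
# The archimedean assembly of #85 with the globalization letter A6 at `U(2,1)` only (`_u21` adapters for the T1a line ED. 10)

Cell `hodgecm-mathlib`, F0∕P3b, line `Cruxes/H413/Lines/F0_T1a_ArchCharactersLinIndep.lean` (T1a; LEAD F0P3b-p01 (g3)); A-p06 (g24), on the LEAD's word
2026-08-31T21:45:06Z (3) and referee F0P3b-ref2 (g0)'s junction pre-cert 20:34:14Z (`JUNCTION-A6-at-U21-precert` 190b6ffd3244f0e3, LEAD «=» 20:36:17Z).
THEOREMS ONLY (no `def`, no instance, no notation, no `sorry`); axioms ⊆ {propext, Classical.choice, Quot.sound}; `--supports stmt-HodgeConjecture-24833`.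

WHY.  Since ED. 9 the T1a line is closed modulo EXACTLY the letter A6 ★ `HasUnitaryGlobalizationOfInfUnitary` [KnappVogan1995, Thm. 0.6 (a)] — stated for
ALL `U(p,q)`.  The in-house road ROAD-GLOB (A6 #92) proves it at `U(2,1)` ONLY (`hasUnitaryGlobalization_of_isInfUnitary_uTwoOne`, file
`HasUnitaryGlobalizationOfInfUnitaryU21`).  The letter's NAME sits in three registered T1a statements (`stub_globExists`, the third hypothesis of
`stub_archAssembly`, the binders `hGE`∕`hAS` of `archCharactersLinIndep_of_stubs`) and in the ★ closer `F0T1aArchAssembly.archAssembly_holds` ∕ ★ (γ)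
`archRealCase_of_package` — which USES it only at `(Fin 2, Fin 1)`.  This file supplies the adapters with the letter weakened to its `(2,1)` body, so that
ED. 10 can re-type `stub_globExists` to the `(2,1)` text and close `stub_archAssembly` by `archAssembly_holds_u21`, head texts byte-unchanged.

## Main results (namespace `Summit.HodgeConjecture.HodgeConjecture.Cruxes.H413.F0T1aArchRealCaseU21`)

* `archRealCase_of_package_u21` — ★ (γ) `archRealCase_of_package` with `hGE` weakened to
  `∀ r : GKIrrep (uFormGroup (Fin 2) (Fin 1)), IsAdmissibleGK r.ρK → Liu2021.LemD2.IsInfUnitary r.ρK r.ρ𝔤 → HasUnitaryGlobalization _ (GKIrrClass.mk r)`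
  (proof verbatim but for the one token `hGE (Fin 2) (Fin 1) r` ↦ `hGE r`).
* **`archAssembly_holds_u21`** — the TYPE of the re-typed `stub_archAssembly` of ED. 10: A1 (idle) → A5 (∀-text) → A6₂₁ → A7′ → ⟨body of `ArchRealCase`⟩,
  `:= fun _ hTC hGE hIR => archRealCase_of_package_u21 hTC hGE hIR sixClauses_holds archTestKc_package` (★ (α), ★ (β) by name).
* `archCharactersLinIndep_of_letters_u21`, `archCharactersLinIndep_closed_of_letters_u21` — ★ `Rogawski1990.ArchCharactersLinIndep L ι H T hT νinf` at every frame
  from A5 (∀-text) + A6₂₁ + A7′ (★ A1 `weightedHilbertSchmidtVanishing_holds` and ★ A8 `archRealReduction` supplied): the shape T1b's `stub_archFactor` consumes.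
* `hasUnitaryGlobalization_uTwoOne_of_letter` — the full letter implies its `(2,1)` body (specialisation): the ED. 9 hypotheses imply the ED. 10 ones, for the record.

HONEST LABEL: HC_CM is proved only modulo the 2 remaining named inputs (hLiu418, h413) until rung 0 closes; this file is unconditional and closes no stub by
itself (it re-bases the T1a assembly on the `(2,1)` instance of A6, which ROAD-GLOB pays in-house).

## References
* J.-P. Labesse, R. P. Langlands, *L-indistinguishability for SL(2)*, Canad. J. Math. 31 (1979), Lemma 6.1 pp. 768–769 [LabesseLanglands1979].
* J. D. Rogawski, *Automorphic Representations of Unitary Groups in Three Variables* (1990), Prop. 13.8.1 p. 212 [Rogawski1990].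
* H. Jacquet, R. P. Langlands, *Automorphic Forms on GL(2)*, LNM 114 (1970), §16, Lemma 16.1.1 (proof) p. 498 [JacquetLanglands1970].
* A. W. Knapp, D. A. Vogan, *Cohomological Induction and Unitary Representations* (1995), Introduction Thm. 0.6 (a) [KnappVogan1995].
-/

set_option autoImplicit false
set_option linter.dupNamespace false

noncomputable section

open NumberField MeasureTheory CompactlySupported Filter Topology
open scoped Matrix ComplexConjugate InnerProductSpace ENNReal NNReal

namespace Summit.HodgeConjecture.HodgeConjecture.Cruxes.H413.F0T1aArchRealCaseU21

open Literature.NumberTheory.Rogawski1990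
open Literature.NumberTheory.Automorphic Literature.NumberTheory.Automorphic.UnitaryGroup
open Literature.NumberTheory.Automorphic.UnitaryGroup.CotangentForms
open Literature.RepresentationTheory Literature.RepresentationTheory.KonnoKonno2007 Literature.RepresentationTheory.KonnoKonno2007.RealDualPair

/-! ## §1 (γ) with the globalization letter at `(2,1)` only -/

section Assembly

open NumberField.mixedEmbedding
-- `Classical` ∕ `ComplexOrder`: the scopes under which typ-T1a's Lines texts `ArchRealCase` ∕ `ArchTestKcPackage` are elaborated (token-for-token match).
open scoped Classical ComplexOrder

/-- **`ArchRealCase` FROM THE PACKAGE WITH THE GLOBALIZATION LETTER AT `U(2,1)` ONLY — Labesse–Langlands' Lemma 6.1 INSTANTIATED** at the pulled-back unitary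
globalizations of record `y ↦ ϖ_y ∘ archProjUForm` over the support of a real coefficient family `b` and the operator families of `ArchTestKc` functions (★ (γ)
`Rogawski1990.archRealCase_of_package`, p827732, with its hypothesis `hGE : HasUnitaryGlobalizationOfInfUnitary` (the letter for ALL `U(p,q)`) WEAKENED to the
letter's body at `(p,q) = (2,1)` — the only instance the proof uses — and the one proof token `hGE (Fin 2) (Fin 1) r` ↦ `hGE r`; everything else verbatim).
Hypotheses: `hTC` = the text of ★ `ArchIntegratedOperatorTraceClass` at every frame (A5), `hGE` = ★ text `HasUnitaryGlobalizationOfInfUnitary` AT `(Fin 2, Fin 1)` (A6₂₁),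
`hIR` = ★ text `UnitaryGlobalizationIrreducible` (A7′), `hα` = the six-clause bridge (A6a), `hβ` = the body of typ-T1a's `ArchTestKcPackage` ((a) `*`-algebra,
(b) bi-`K_c`-averages — unused —, (c) Dirac sequence); conclusion = the body of typ-T1a's `ArchRealCase`.  Uses ★ A1 in the universe-polymorphic form
`forall_weight_eq_zero_of_tsum_weighted_hilbertSchmidt_eq_zero` and ★ A7 `not_areUnitarilyEquivalent_globOfRecord_of_ne`.
[cite: LabesseLanglands1979, Lemma 6.1 pp. 768–769] [cite: Rogawski1990, Prop. 13.8.1 p. 212] [cite: JacquetLanglands1970, §16, Lemma 16.1.1 (proof) p. 498] -/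
theorem archRealCase_of_package_u21
    (hTC : ∀ (L : Type) [Field L] [NumberField L] [IsCMField L] (ι : L →+* ℂ) (H : Matrix (Fin 3) (Fin 3) L) (T : GL (Fin 3) ℂ)
      (hT : (T : Matrix (Fin 3) (Fin 3) ℂ)ᴴ * H.map ι * (T : Matrix (Fin 3) (Fin 3) ℂ) = Literature.Geometry.ComplexHyperbolic.BallModel.J)
      (νinf : @Measure (UnitaryGroup.arch (↥(maximalRealSubfield L)) L (IsCMField.complexConj L) 3 H) (borel _)),
      ArchIntegratedOperatorTraceClass L ι H T hT νinf)
    (hGE : ∀ r : GKIrrep (uFormGroup (Fin 2) (Fin 1)),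
      IsAdmissibleGK r.ρK → Liu2021.LemD2.IsInfUnitary r.ρK r.ρ𝔤 → HasUnitaryGlobalization (uFormGroup (Fin 2) (Fin 1)) (GKIrrClass.mk r))
    (hIR : UnitaryGlobalizationIrreducible)
    (hα : ∀ r : GKIrrep (uFormGroup (Fin 2) (Fin 1)), IsAdmissibleGK r.ρK → r.IsInfUnitaryAlongP → Liu2021.LemD2.IsInfUnitary r.ρK r.ρ𝔤)
    (hβ : ∀ (L : Type) [Field L] [NumberField L] [IsCMField L] (ι : L →+* ℂ) (H : Matrix (Fin 3) (Fin 3) L) (T : GL (Fin 3) ℂ)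
      (hT : (T : Matrix (Fin 3) (Fin 3) ℂ)ᴴ * H.map ι * (T : Matrix (Fin 3) (Fin 3) ℂ) = Literature.Geometry.ComplexHyperbolic.BallModel.J)
      (νinf : @Measure (UnitaryGroup.arch (↥(maximalRealSubfield L)) L (IsCMField.complexConj L) 3 H) (borel _)),
      letI : MeasurableSpace (UnitaryGroup.arch (↥(maximalRealSubfield L)) L (IsCMField.complexConj L) 3 H) := borel _
      haveI : BorelSpace (UnitaryGroup.arch (↥(maximalRealSubfield L)) L (IsCMField.complexConj L) 3 H) := ⟨rfl⟩
      (∀ τ' : L →+* ℂ, InfinitePlace.mk τ' ≠ InfinitePlace.mk ι → (H.map τ').PosDef) →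
      ∀ (_hν : νinf.IsHaarMeasure),
        -- (a) `*`-algebra
        (∀ φ : UnitaryGroup.arch (↥(maximalRealSubfield L)) L (IsCMField.complexConj L) 3 H → ℂ, ArchTestKc L ι H T hT φ →
            ArchTestKc L ι H T hT (mulStar φ) ∧
            ∀ ψ : UnitaryGroup.arch (↥(maximalRealSubfield L)) L (IsCMField.complexConj L) 3 H → ℂ, ArchTestKc L ι H T hT ψ →
              ArchTestKc L ι H T hT (mulConv νinf φ ψ)) ∧
        -- (b) bi-`K_c`-average with the same operator on `K_c`-trivial representations
        (∀ ψ : UnitaryGroup.arch (↥(maximalRealSubfield L)) L (IsCMField.complexConj L) 3 H → ℂ, ∀ (hψc : Continuous ψ) (hψs : HasCompactSupport ψ),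
            (∃ ψ' : GL (Fin 3) (NumberField.mixedEmbedding.mixedSpace L) → ℂ, Continuous ψ' ∧ HasCompactSupport ψ' ∧
                IsArchSmooth (archGroupGL 3 L).carrier.subtype ψ' ∧
                ∀ k : UnitaryGroup.arch (↥(maximalRealSubfield L)) L (IsCMField.complexConj L) 3 H,
                  ψ k = ψ' (k : GL (Fin 3) (NumberField.mixedEmbedding.mixedSpace L))) →
            ∃ (ψn : UnitaryGroup.arch (↥(maximalRealSubfield L)) L (IsCMField.complexConj L) 3 H → ℂ) (hψn : ArchTestKc L ι H T hT ψn),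
              ∀ (x : GKIrrClass (uFormGroup (Fin 2) (Fin 1)))
                (E : Type) [NormedAddCommGroup E] [InnerProductSpace ℂ E] [CompleteSpace E]
                (ϖ : ContRepresentation ℂ (uFormGroup (Fin 2) (Fin 1)).carrier E) (hϖ : IsUnitaryGlobalization (uFormGroup (Fin 2) (Fin 1)) x ϖ),
                (ϖ.restrict (archProjUForm L ι H T hT)).integratedOperator (hϖ.isUnitary.restrict _)
                    (hϖ.isStronglyContinuous.restrict _ (continuous_archProjUForm L ι H T hT)) νinf ⟨⟨ψn, hψn.continuous⟩, hψn.hasCompactSupport⟩ =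
                  (ϖ.restrict (archProjUForm L ι H T hT)).integratedOperator (hϖ.isUnitary.restrict _)
                    (hϖ.isStronglyContinuous.restrict _ (continuous_archProjUForm L ι H T hT)) νinf ⟨⟨ψ, hψc⟩, hψs⟩) ∧
        -- (c) Dirac sequence in `ArchTestKc` for the `K_c`-trivial unitary globalizations
        (∃ (φn : ℕ → UnitaryGroup.arch (↥(maximalRealSubfield L)) L (IsCMField.complexConj L) 3 H → ℂ) (hφn : ∀ n, ArchTestKc L ι H T hT (φn n)),
            ∀ (x : GKIrrClass (uFormGroup (Fin 2) (Fin 1)))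
              (E : Type) [NormedAddCommGroup E] [InnerProductSpace ℂ E] [CompleteSpace E]
              (ϖ : ContRepresentation ℂ (uFormGroup (Fin 2) (Fin 1)).carrier E) (hϖ : IsUnitaryGlobalization (uFormGroup (Fin 2) (Fin 1)) x ϖ) (v : E),
              Tendsto (fun n => (ϖ.restrict (archProjUForm L ι H T hT)).integratedOperator (hϖ.isUnitary.restrict _)
                  (hϖ.isStronglyContinuous.restrict _ (continuous_archProjUForm L ι H T hT)) νinf
                  ⟨⟨φn n, (hφn n).continuous⟩, (hφn n).hasCompactSupport⟩ v) atTop (𝓝 v))) :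
    ∀ (L : Type) [Field L] [NumberField L] [IsCMField L] (ι : L →+* ℂ) (H : Matrix (Fin 3) (Fin 3) L) (T : GL (Fin 3) ℂ)
      (hT : (T : Matrix (Fin 3) (Fin 3) ℂ)ᴴ * H.map ι * (T : Matrix (Fin 3) (Fin 3) ℂ) = Literature.Geometry.ComplexHyperbolic.BallModel.J)
      (νinf : @Measure (UnitaryGroup.arch (↥(maximalRealSubfield L)) L (IsCMField.complexConj L) 3 H) (borel _)),
      (∀ τ' : L →+* ℂ, InfinitePlace.mk τ' ≠ InfinitePlace.mk ι → (H.map τ').PosDef) →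
      @Measure.IsHaarMeasure _ _ _ (borel _) νinf →
      ∀ (b : GKIrrClass (uFormGroup (Fin 2) (Fin 1)) → ℝ),
        (∀ y, b y ≠ 0 →
          ∃ r : GKIrrep (uFormGroup (Fin 2) (Fin 1)), GKIrrClass.mk r = y ∧ IsAdmissibleGK r.ρK ∧ r.IsInfUnitaryAlongP) →
        (∀ φ : UnitaryGroup.arch (↥(maximalRealSubfield L)) L (IsCMField.complexConj L) 3 H → ℂ,
            ArchTestKc L ι H T hT φ → Summable fun y => (b y : ℂ) * archTr₀ L ι H T hT νinf y φ) →
        (∀ φ : UnitaryGroup.arch (↥(maximalRealSubfield L)) L (IsCMField.complexConj L) 3 H → ℂ,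
            ArchTestKc L ι H T hT φ → ∑' y, (b y : ℂ) * archTr₀ L ι H T hT νinf y φ = 0) →
        ∀ y, b y = 0 := by
  intro L _ _ _ ι H T hT νinf hdef hν b hsupp hsum hzero y₀
  by_contra hy₀
  /- measure-theoretic instances on `G′_∞` -/
  letI mS : MeasurableSpace (UnitaryGroup.arch (↥(maximalRealSubfield L)) L (IsCMField.complexConj L) 3 H) := borel _
  haveI : BorelSpace (UnitaryGroup.arch (↥(maximalRealSubfield L)) L (IsCMField.complexConj L) 3 H) := ⟨rfl⟩
  haveI : νinf.IsHaarMeasure := hν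
  haveI : νinf.IsMulRightInvariant :=
    isMulRightInvariant_of_modularCharacterFun_eq_one
      (fun g => modularCharacterFun_arch_eq_one L H (transpose_map_cmConjRingHom_eq_of_frame L ι H T hT)
        (isUnit_det_of_frame L ι H T hT).ne_zero g) νinf
  haveI : νinf.IsInvInvariant := isInvInvariant_of_isMulRightInvariant νinf
  /- the package at this frame -/
  obtain ⟨hβa, -, φn, hφn, hDirac⟩ := hβ L ι H T hT νinf hdef hν
  /- unitary globalizations exist on the support (support clause + A6a + A6) -/
  have hglob : ∀ y : GKIrrClass (uFormGroup (Fin 2) (Fin 1)), b y ≠ 0 → HasUnitaryGlobalization (uFormGroup (Fin 2) (Fin 1)) y := by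
    intro y hy
    obtain ⟨r, hr, hadm, hinf⟩ := hsupp y hy
    rw [← hr]
    exact hGE r hadm (hα r hadm hinf)
  /- the globalization of record `W y` on the support, its pull-back `π y` to `G′_∞` (unitary, strongly continuous, irreducible, inequivalent) -/
  let W : (y : {y : GKIrrClass (uFormGroup (Fin 2) (Fin 1)) // b y ≠ 0}) → UnitaryGlobalization (G := uFormGroup (Fin 2) (Fin 1)) y.1 :=
    fun y => globOfRecord y.1 (hglob y.1 y.2)
  let π : (y : {y : GKIrrClass (uFormGroup (Fin 2) (Fin 1)) // b y ≠ 0}) →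
      ContRepresentation ℂ (UnitaryGroup.arch (↥(maximalRealSubfield L)) L (IsCMField.complexConj L) 3 H) (W y).E :=
    fun y => (W y).ϖ.restrict (archProjUForm L ι H T hT)
  have hu : ∀ y, (π y).IsUnitary := fun y => (W y).isUnitaryGlobalization.isUnitary.restrict _
  have hc : ∀ y, (π y).IsStronglyContinuous := fun y =>
    (W y).isUnitaryGlobalization.isStronglyContinuous.restrict _ (continuous_archProjUForm L ι H T hT)
  have hirrW : ∀ y, (W y).ϖ.IsTopIrreducible := fun y => by
    obtain ⟨r, hr, hadm, -⟩ := hsupp y.1 y.2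
    exact hIR (Fin 2) (Fin 1) y.1 ⟨r, hr, hadm⟩ (W y).E (W y).ϖ (W y).isUnitaryGlobalization
  have hirr : ∀ y, (π y).IsTopIrreducible := fun y =>
    isTopIrreducible_restrict_of_surjective _ (archProjUForm_surjective L ι H T hT) (hirrW y)
  have hne : ∀ y y', y ≠ y' → ¬ ContRepresentation.AreUnitarilyEquivalent (π y) (π y') := fun y y' hyy' he =>
    not_areUnitarilyEquivalent_globOfRecord_of_ne (fun h => hyy' (Subtype.ext h)) (hglob y.1 y.2) (hglob y'.1 y'.2)
      (areUnitarilyEquivalent_of_restrict _ (archProjUForm_surjective L ι H T hT) he)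
  /- the subspace `B` of the operator families `((ϖ_y ∘ proj)(f))_y`, `f ∈ ArchTestKc` -/
  have hOp_add : ∀ y (f f' : C_c(UnitaryGroup.arch (↥(maximalRealSubfield L)) L (IsCMField.complexConj L) 3 H, ℂ)),
      (π y).integratedOperator (hu y) (hc y) νinf (f + f') =
        (π y).integratedOperator (hu y) (hc y) νinf f + (π y).integratedOperator (hu y) (hc y) νinf f' := fun y f f' =>
    ContRepresentation.integratedOperator_add (hu y) (hc y) νinf f f'
  have hOp_smul : ∀ y (c : ℂ) (f : C_c(UnitaryGroup.arch (↥(maximalRealSubfield L)) L (IsCMField.complexConj L) 3 H, ℂ)),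
      (π y).integratedOperator (hu y) (hc y) νinf (c • f) = c • (π y).integratedOperator (hu y) (hc y) νinf f := fun y c f =>
    ContRepresentation.integratedOperator_smul (hu y) (hc y) νinf c f
  have hOp_zero : ∀ y, (π y).integratedOperator (hu y) (hc y) νinf 0 = 0 := fun y => by
    rw [← zero_smul ℂ (0 : C_c(UnitaryGroup.arch (↥(maximalRealSubfield L)) L (IsCMField.complexConj L) 3 H, ℂ)), hOp_smul, zero_smul]
  obtain ⟨B, hBmem⟩ : ∃ B : Submodule ℂ (∀ y : {y : GKIrrClass (uFormGroup (Fin 2) (Fin 1)) // b y ≠ 0}, (W y).E →L[ℂ] (W y).E),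
      ∀ F, F ∈ B ↔ ∃ f : C_c(UnitaryGroup.arch (↥(maximalRealSubfield L)) L (IsCMField.complexConj L) 3 H, ℂ),
        ArchTestKc L ι H T hT f ∧ ∀ y, F y = (π y).integratedOperator (hu y) (hc y) νinf f :=
    ⟨{ carrier := {F | ∃ f : C_c(UnitaryGroup.arch (↥(maximalRealSubfield L)) L (IsCMField.complexConj L) 3 H, ℂ),
          ArchTestKc L ι H T hT f ∧ ∀ y, F y = (π y).integratedOperator (hu y) (hc y) νinf f}
       add_mem' := by
         rintro F F' ⟨f, hf, hF⟩ ⟨f', hf', hF'⟩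
         exact ⟨f + f', hf.add hf', fun y => by rw [Pi.add_apply, hF, hF', hOp_add]⟩
       zero_mem' := ⟨0, ArchTestKc.zero, fun y => by rw [Pi.zero_apply, hOp_zero]⟩
       smul_mem' := by
         rintro c F ⟨f, hf, hF⟩
         exact ⟨c • f, hf.smul c, fun y => by rw [Pi.smul_apply, hF, hOp_smul]⟩ }, fun F => Iff.rfl⟩
  /- `B` is stable under left multiplication by `(ϖ_y(proj g))_y` (translation-closure of `ArchTestKc`) -/
  have hG : ∀ (g : UnitaryGroup.arch (↥(maximalRealSubfield L)) L (IsCMField.complexConj L) 3 H), ∀ F ∈ B,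
      (fun y => π y g * F y) ∈ B := by
    intro g F hF
    obtain ⟨f, hf, hFf⟩ := (hBmem F).1 hF
    have hfg : ArchTestKc L ι H T hT fun x => f (g⁻¹ * x) := hf.comp_mul_left g
    refine (hBmem _).2 ⟨⟨⟨fun x => f (g⁻¹ * x), hfg.continuous⟩, hfg.hasCompactSupport⟩, hfg, fun y => ?_⟩
    rw [hFf y]
    exact ContRepresentation.apply_comp_integratedOperator (hu y) (hc y) νinf g f _ fun x => rfl
  /- `B` is non-degenerate on every `ϖ_y ∘ proj` (Dirac sequence (c)) -/
  have hnd : ∀ y, ∃ F ∈ B, F y ≠ 0 := by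
    intro y
    haveI : Nontrivial (W y).E := ((ContRepresentation.isTopIrreducible_iff _).1 (hirrW y)).1
    obtain ⟨v, hv⟩ := exists_ne (0 : (W y).E)
    by_contra hall
    push Not at hall
    have hT := hDirac y.1 (W y).E (W y).ϖ (W y).isUnitaryGlobalization v
    have h0 : ∀ n, (π y).integratedOperator (hu y) (hc y) νinf ⟨⟨φn n, (hφn n).continuous⟩, (hφn n).hasCompactSupport⟩ v = 0 := by
      intro n
      have hmem := (hBmem fun y' => (π y').integratedOperator (hu y') (hc y') νinf
        ⟨⟨φn n, (hφn n).continuous⟩, (hφn n).hasCompactSupport⟩).2 ⟨_, hφn n, fun y' => rfl⟩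
      rw [hall _ hmem, zero_apply]
    have hT0 : Tendsto (fun _ : ℕ => (0 : (W y).E)) atTop (𝓝 v) := hT.congr fun n => h0 n
    exact hv (tendsto_nhds_unique hT0 tendsto_const_nhds)
  /- Hilbert–Schmidt along the bases of record (A5 (i)) -/
  have hHS : ∀ F ∈ B, ∀ y, Summable fun k => ‖F y (globBasis y.1 (hglob y.1 y.2) k)‖ ^ 2 := by
    intro F hF y
    obtain ⟨f, hf, hFf⟩ := (hBmem F).1 hF
    have h1 := (hTC L ι H T hT νinf hν y.1 (W y).E (W y).ϖ (W y).isUnitaryGlobalization f f.continuous f.hasCompactSupport hf.1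
      _ (globBasis y.1 (hglob y.1 y.2))).1
    have h1' : (∑' k, (‖(π y).integratedOperator (hu y) (hc y) νinf f (globBasis y.1 (hglob y.1 y.2) k)‖₊ : ℝ≥0∞) ^ 2) ≠ ∞ :=
      h1.ne
    have hs : Summable fun k => ‖(π y).integratedOperator (hu y) (hc y) νinf f (globBasis y.1 (hglob y.1 y.2) k)‖₊ ^ 2 := by
      rw [← ENNReal.tsum_coe_ne_top_iff_summable]
      simpa only [ENNReal.coe_pow] using h1'
    rw [hFf y]
    simpa only [NNReal.coe_pow, coe_nnnorm] using NNReal.summable_coe.2 hs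
  /- the weights: `b y · Θ_y(f^* ⋆ f) = b y · ‖(ϖ_y ∘ proj)(f)‖²_{HS}` on the support, so (6.1) holds on `B` -/
  have hl : ∀ F ∈ B, Summable (fun y : {y : GKIrrClass (uFormGroup (Fin 2) (Fin 1)) // b y ≠ 0} =>
        b y.1 * ∑' k, ‖F y (globBasis y.1 (hglob y.1 y.2) k)‖ ^ 2) ∧
      ∑' y : {y : GKIrrClass (uFormGroup (Fin 2) (Fin 1)) // b y ≠ 0}, b y.1 * ∑' k, ‖F y (globBasis y.1 (hglob y.1 y.2) k)‖ ^ 2 = 0 := by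
    intro F hF
    obtain ⟨f, hf, hFf⟩ := (hBmem F).1 hF
    have hfs : ArchTestKc L ι H T hT (mulStar ⇑f) := (hβa _ hf).1
    have hψ : ArchTestKc L ι H T hT (mulConv νinf (mulStar ⇑f) ⇑f) := (hβa _ hfs).2 _ hf
    let fs : C_c(UnitaryGroup.arch (↥(maximalRealSubfield L)) L (IsCMField.complexConj L) 3 H, ℂ) :=
      ⟨⟨mulStar ⇑f, hfs.continuous⟩, hfs.hasCompactSupport⟩
    let ψ : C_c(UnitaryGroup.arch (↥(maximalRealSubfield L)) L (IsCMField.complexConj L) 3 H, ℂ) :=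
      ⟨⟨mulConv νinf (mulStar ⇑f) ⇑f, hψ.continuous⟩, hψ.hasCompactSupport⟩
    -- the termwise identity on the support
    have hid : ∀ y : {y : GKIrrClass (uFormGroup (Fin 2) (Fin 1)) // b y ≠ 0},
        (b y.1 : ℂ) * archTr₀ L ι H T hT νinf y.1 (mulConv νinf (mulStar ⇑f) ⇑f) =
          ((b y.1 * ∑' k, ‖F y (globBasis y.1 (hglob y.1 y.2) k)‖ ^ 2 : ℝ) : ℂ) := by
      intro y
      have hcomp : (π y).integratedOperator (hu y) (hc y) νinf ψ =
          (π y).integratedOperator (hu y) (hc y) νinf fs ∘L (π y).integratedOperator (hu y) (hc y) νinf f :=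
        (ContRepresentation.integratedOperator_comp_integratedOperator (hu y) (hc y) νinf fs f ψ fun x => rfl).symm
      have hadj : (π y).integratedOperator (hu y) (hc y) νinf fs =
          ContinuousLinearMap.adjoint ((π y).integratedOperator (hu y) (hc y) νinf f) :=
        (ContRepresentation.adjoint_integratedOperator (hu y) (hc y) νinf f fs fun x => rfl).symm
      rw [archTr₀_eq_tsum L ι H T hT νinf y.1 _ (hglob y.1 y.2) hψ.continuous hψ.hasCompactSupport inferInstance,
        Complex.ofReal_mul, Complex.ofReal_tsum]
      congr 1
      refine tsum_congr fun k => ?_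
      change ⟪(globBasis y.1 (hglob y.1 y.2) k : (W y).E), (π y).integratedOperator (hu y) (hc y) νinf ψ (globBasis y.1 (hglob y.1 y.2) k)⟫_ℂ = _
      rw [hcomp, ContinuousLinearMap.comp_apply, hadj, ContinuousLinearMap.adjoint_inner_right, hFf y, inner_self_eq_norm_sq_to_K]
      norm_cast
    have hfun : (fun y : GKIrrClass (uFormGroup (Fin 2) (Fin 1)) => (b y : ℂ) * archTr₀ L ι H T hT νinf y (mulConv νinf (mulStar ⇑f) ⇑f)) ∘
          (Subtype.val : {y : GKIrrClass (uFormGroup (Fin 2) (Fin 1)) // b y ≠ 0} → GKIrrClass (uFormGroup (Fin 2) (Fin 1))) =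
        fun y => ((b y.1 * ∑' k, ‖F y (globBasis y.1 (hglob y.1 y.2) k)‖ ^ 2 : ℝ) : ℂ) := funext hid
    have hs : Summable fun y : {y : GKIrrClass (uFormGroup (Fin 2) (Fin 1)) // b y ≠ 0} =>
        ((b y.1 * ∑' k, ‖F y (globBasis y.1 (hglob y.1 y.2) k)‖ ^ 2 : ℝ) : ℂ) := by
      rw [← hfun]
      exact (hsum _ hψ).subtype _
    refine ⟨Complex.summable_ofReal.1 hs, ?_⟩
    have htot := hzero _ hψ
    rw [← tsum_subtype_eq_of_support_subset (s := {y : GKIrrClass (uFormGroup (Fin 2) (Fin 1)) | b y ≠ 0}) ?_] at htot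
    · have h2 : ∑' y : {y : GKIrrClass (uFormGroup (Fin 2) (Fin 1)) // b y ≠ 0},
          ((b y.1 * ∑' k, ‖F y (globBasis y.1 (hglob y.1 y.2) k)‖ ^ 2 : ℝ) : ℂ) = 0 := by
        rw [← htot]
        exact (tsum_congr fun y => (hid y).symm)
      rw [← Complex.ofReal_tsum] at h2
      exact_mod_cast h2
    · intro y hy
      rw [Function.mem_support] at hy
      intro hby
      exact hy (by rw [show b y = 0 from hby, Complex.ofReal_zero, zero_mul])
  /- Labesse–Langlands' Lemma 6.1 (★ A1): every weight on the support vanishes — absurd at `y₀` -/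
  exact hy₀ (forall_weight_eq_zero_of_tsum_weighted_hilbertSchmidt_eq_zero π hu hirr hne B hG hnd
    (fun y => globBasis y.1 (hglob y.1 y.2)) hHS (fun y => b y.1) hl ⟨y₀, hy₀⟩)

end Assembly

/-! ## §2 The re-typed assembly stub and the parametrised letter -/

section Closer

-- `Classical` ∕ `ComplexOrder`: the scopes under which the Lines texts are elaborated (token-for-token match), as in ★ `F0T1aArchAssembly`.
open scoped Classical ComplexOrder

/-- **`stub_archAssembly` OF ED. 10, CLOSED — Labesse–Langlands' Lemma 6.1 INSTANTIATED, with the globalization letter at `U(2,1)` only**: the abstract node A1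
(idle binder), the trace-class letter A5 (∀-text), the globalization letter A6 AT `(Fin 2, Fin 1)` and the irreducibility letter A7′ imply the body of `ArchRealCase`,
by `archRealCase_of_package_u21` fed with ★ (α) `sixClauses_holds` and ★ (β) `archTestKc_package`.  (= ★ `F0T1aArchAssembly.archAssembly_holds`, p828141, with its
third hypothesis `HasUnitaryGlobalizationOfInfUnitary` replaced by the letter's `(2,1)` body.) [cite: LabesseLanglands1979, Lemma 6.1 pp. 768–769]
[cite: Rogawski1990, Prop. 13.8.1 p. 212] [cite: JacquetLanglands1970, Lemma 16.1.1 (proof) p. 498] -/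
theorem archAssembly_holds_u21 :
    WeightedHilbertSchmidtVanishing →
    (∀ (L : Type) [Field L] [NumberField L] [IsCMField L] (ι : L →+* ℂ) (H : Matrix (Fin 3) (Fin 3) L) (T : GL (Fin 3) ℂ)
      (hT : (T : Matrix (Fin 3) (Fin 3) ℂ)ᴴ * H.map ι * (T : Matrix (Fin 3) (Fin 3) ℂ) = Literature.Geometry.ComplexHyperbolic.BallModel.J)
      (νinf : @Measure (UnitaryGroup.arch (↥(maximalRealSubfield L)) L (IsCMField.complexConj L) 3 H) (borel _)),
      ArchIntegratedOperatorTraceClass L ι H T hT νinf) →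
    (∀ r : GKIrrep (uFormGroup (Fin 2) (Fin 1)),
      IsAdmissibleGK r.ρK → Liu2021.LemD2.IsInfUnitary r.ρK r.ρ𝔤 → HasUnitaryGlobalization (uFormGroup (Fin 2) (Fin 1)) (GKIrrClass.mk r)) →
    UnitaryGlobalizationIrreducible →
    ∀ (L : Type) [Field L] [NumberField L] [IsCMField L] (ι : L →+* ℂ) (H : Matrix (Fin 3) (Fin 3) L) (T : GL (Fin 3) ℂ)
      (hT : (T : Matrix (Fin 3) (Fin 3) ℂ)ᴴ * H.map ι * (T : Matrix (Fin 3) (Fin 3) ℂ) = Literature.Geometry.ComplexHyperbolic.BallModel.J)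
      (νinf : @Measure (UnitaryGroup.arch (↥(maximalRealSubfield L)) L (IsCMField.complexConj L) 3 H) (borel _)),
      (∀ τ' : L →+* ℂ, InfinitePlace.mk τ' ≠ InfinitePlace.mk ι → (H.map τ').PosDef) →
      @Measure.IsHaarMeasure _ _ _ (borel _) νinf →
      ∀ (b : GKIrrClass (uFormGroup (Fin 2) (Fin 1)) → ℝ),
        (∀ y, b y ≠ 0 →
          ∃ r : GKIrrep (uFormGroup (Fin 2) (Fin 1)), GKIrrClass.mk r = y ∧ IsAdmissibleGK r.ρK ∧ r.IsInfUnitaryAlongP) →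
        (∀ φ : UnitaryGroup.arch (↥(maximalRealSubfield L)) L (IsCMField.complexConj L) 3 H → ℂ,
            ArchTestKc L ι H T hT φ → Summable fun y => (b y : ℂ) * archTr₀ L ι H T hT νinf y φ) →
        (∀ φ : UnitaryGroup.arch (↥(maximalRealSubfield L)) L (IsCMField.complexConj L) 3 H → ℂ,
            ArchTestKc L ι H T hT φ → ∑' y, (b y : ℂ) * archTr₀ L ι H T hT νinf y φ = 0) →
        ∀ y, b y = 0 :=
  fun _hW hTC hGE hIR => archRealCase_of_package_u21 hTC hGE hIR sixClauses_holds archTestKc_package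

/-- **The ED. 9 hypotheses imply the ED. 10 ones** (for the record): the full letter ★ `HasUnitaryGlobalizationOfInfUnitary` specialises to its `(2,1)` body, so
★ `F0T1aArchAssembly.archAssembly_holds`'s conclusion also follows from `archAssembly_holds_u21`. [cite: KnappVogan1995, Introduction Thm. 0.6 (a)] -/
theorem hasUnitaryGlobalization_uTwoOne_of_letter (hGE : HasUnitaryGlobalizationOfInfUnitary) :
    ∀ r : GKIrrep (uFormGroup (Fin 2) (Fin 1)),
      IsAdmissibleGK r.ρK → Liu2021.LemD2.IsInfUnitary r.ρK r.ρ𝔤 → HasUnitaryGlobalization (uFormGroup (Fin 2) (Fin 1)) (GKIrrClass.mk r) :=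
  fun r hadm hu => hGE (Fin 2) (Fin 1) r hadm hu

/-- **THE ARCHIMEDEAN FACTOR OF #85 FROM A5, A6 AT `U(2,1)`, A7′** — for every CM frame `(L, ι, H, T)` and Borel measure `νinf` on `G′_∞`: the trace-class letter A5
(∀-text), the globalization letter A6 at `(Fin 2, Fin 1)` and the irreducibility letter A7′ imply ★ `Rogawski1990.ArchCharactersLinIndep L ι H T hT νinf`
[Rogawski1990 Prop. 13.8.1 at `S = ∅`]: split `a = Re a + i Im a` by ★ A8 `archRealReduction`, kill both real families by `archAssembly_holds_u21` (★ A1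
`weightedHilbertSchmidtVanishing_holds` supplied), `Complex.ext` (= ★ `F0T1aArchAssembly.archCharactersLinIndep_of_letters` with A6 at `(2,1)`).  This is the TYPE of
T1b's `stub_archFactor` after its letter binders, A6 read at `(2,1)`. [cite: Rogawski1990, Prop. 13.8.1 p. 212] [cite: LabesseLanglands1979, Lemma 6.1 pp. 768–769] -/
theorem archCharactersLinIndep_of_letters_u21
    (hTC : ∀ (L : Type) [Field L] [NumberField L] [IsCMField L] (ι : L →+* ℂ) (H : Matrix (Fin 3) (Fin 3) L) (T : GL (Fin 3) ℂ)
      (hT : (T : Matrix (Fin 3) (Fin 3) ℂ)ᴴ * H.map ι * (T : Matrix (Fin 3) (Fin 3) ℂ) = Literature.Geometry.ComplexHyperbolic.BallModel.J)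
      (νinf : @Measure (UnitaryGroup.arch (↥(maximalRealSubfield L)) L (IsCMField.complexConj L) 3 H) (borel _)),
      ArchIntegratedOperatorTraceClass L ι H T hT νinf)
    (hGE : ∀ r : GKIrrep (uFormGroup (Fin 2) (Fin 1)),
      IsAdmissibleGK r.ρK → Liu2021.LemD2.IsInfUnitary r.ρK r.ρ𝔤 → HasUnitaryGlobalization (uFormGroup (Fin 2) (Fin 1)) (GKIrrClass.mk r))
    (hIR : UnitaryGlobalizationIrreducible)
    (L : Type) [Field L] [NumberField L] [IsCMField L] (ι : L →+* ℂ) (H : Matrix (Fin 3) (Fin 3) L) (T : GL (Fin 3) ℂ)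
    (hT : (T : Matrix (Fin 3) (Fin 3) ℂ)ᴴ * H.map ι * (T : Matrix (Fin 3) (Fin 3) ℂ) = Literature.Geometry.ComplexHyperbolic.BallModel.J)
    (νinf : @Measure (UnitaryGroup.arch (↥(maximalRealSubfield L)) L (IsCMField.complexConj L) 3 H) (borel _)) :
    ArchCharactersLinIndep L ι H T hT νinf := by
  rw [archCharactersLinIndep_iff]
  intro hdef hν a hsupp hsum hzero y
  have hRC := archAssembly_holds_u21 weightedHilbertSchmidtVanishing_holds hTC hGE hIR
  -- real and imaginary parts (★ A8)
  obtain ⟨⟨hsre, hzre⟩, hsim, hzim⟩ := archRealReduction L ι H T hT νinf hν a hsum hzero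
  have hre : (a y).re = 0 :=
    hRC L ι H T hT νinf hdef hν (fun y => (a y).re)
      (fun y hy => hsupp y fun h => hy (by rw [h, Complex.zero_re])) hsre hzre y
  have him : (a y).im = 0 :=
    hRC L ι H T hT νinf hdef hν (fun y => (a y).im)
      (fun y hy => hsupp y fun h => hy (by rw [h, Complex.zero_im])) hsim hzim y
  exact Complex.ext hre him

/-- **The ∀-closed shape** (the Lines head `ArchCharactersLinIndepClosed`, from A5, A6 at `(2,1)`, A7′): ★ `ArchCharactersLinIndep L ι H T hT νinf` at every frame.
[cite: Rogawski1990, Prop. 13.8.1 p. 212] [cite: LabesseLanglands1979, Lemma 6.1 pp. 768–769] -/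
theorem archCharactersLinIndep_closed_of_letters_u21
    (hTC : ∀ (L : Type) [Field L] [NumberField L] [IsCMField L] (ι : L →+* ℂ) (H : Matrix (Fin 3) (Fin 3) L) (T : GL (Fin 3) ℂ)
      (hT : (T : Matrix (Fin 3) (Fin 3) ℂ)ᴴ * H.map ι * (T : Matrix (Fin 3) (Fin 3) ℂ) = Literature.Geometry.ComplexHyperbolic.BallModel.J)
      (νinf : @Measure (UnitaryGroup.arch (↥(maximalRealSubfield L)) L (IsCMField.complexConj L) 3 H) (borel _)),
      ArchIntegratedOperatorTraceClass L ι H T hT νinf)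
    (hGE : ∀ r : GKIrrep (uFormGroup (Fin 2) (Fin 1)),
      IsAdmissibleGK r.ρK → Liu2021.LemD2.IsInfUnitary r.ρK r.ρ𝔤 → HasUnitaryGlobalization (uFormGroup (Fin 2) (Fin 1)) (GKIrrClass.mk r))
    (hIR : UnitaryGlobalizationIrreducible) :
    ∀ (L : Type) [Field L] [NumberField L] [IsCMField L] (ι : L →+* ℂ) (H : Matrix (Fin 3) (Fin 3) L) (T : GL (Fin 3) ℂ)
      (hT : (T : Matrix (Fin 3) (Fin 3) ℂ)ᴴ * H.map ι * (T : Matrix (Fin 3) (Fin 3) ℂ) = Literature.Geometry.ComplexHyperbolic.BallModel.J)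
      (νinf : @Measure (UnitaryGroup.arch (↥(maximalRealSubfield L)) L (IsCMField.complexConj L) 3 H) (borel _)),
      ArchCharactersLinIndep L ι H T hT νinf :=
  fun L _ _ _ ι H T hT νinf => archCharactersLinIndep_of_letters_u21 hTC hGE hIR L ι H T hT νinf

end Closer

end Summit.HodgeConjecture.HodgeConjecture.Cruxes.H413.F0T1aArchRealCaseU21

end
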